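import Mathlib.Order.Filter.AtTopBot.Basic
import Mathlib.Topology.Instances.Real.Lemmas
import HarnessLib

/-!
# Crux `NearConstantShortTimeHL` (stmt-AtomisticToContinuum-12502), line `small-tilt-domination` — diagonal extraction of eventual bounds

Lead c2, helper of `stub_gronwallAssembly`, step (2): the closure-tightness inputs give, for every FIXED grid size / tolerance index `i`,
a bound valid EVENTUALLY in `N`; the assembly runs at stage `N` with an `N`-dependent index `ι(N) → ∞` (mesh `→ 0`, tolerance `→ 0`).
`exists_diagonal_index`: from `∀ i, ∀ᶠ N, p i N` one extracts `ι : ℕ → ℕ` with `ι → ∞` and `∀ᶠ N, p (ι N) N` (thresholds made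
increasing, `ι(N)` = the largest index whose threshold is `≤ N`).
-/

namespace Summit.AtomisticToContinuum.HydrodynamicLimit.Theorems.NearConstantShortTimeHL

open Filter

/-- **Diagonal extraction.** If for every index `i` the property `p i N` holds eventually in `N`, then there is an index sequence
`ι(N) → ∞` with `p (ι N) N` eventually in `N`. [folklore] -/
theorem exists_diagonal_index : ∀ {p : ℕ → ℕ → Prop}, (∀ i, ∀ᶠ N in atTop, p i N) →
    ∃ ι : ℕ → ℕ, Tendsto ι atTop atTop ∧ ∀ᶠ N in atTop, p (ι N) N := by
  intro p h
  classical
  -- thresholds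
  have hT : ∀ i, ∃ T : ℕ, ∀ N, T ≤ N → p i N := fun i => by
    obtain ⟨T, hT⟩ := eventually_atTop.1 (h i)
    exact ⟨T, hT⟩
  choose T hT using hT
  -- increasing thresholds dominating `T` and the identity
  let S : ℕ → ℕ := fun i => (Finset.range (i + 1)).sup T + i
  have hST : ∀ i, T i ≤ S i := fun i =>
    (Finset.le_sup (f := T) (Finset.mem_range.2 (Nat.lt_succ_self i))).trans (Nat.le_add_right _ _)
  have hSi : ∀ i, i ≤ S i := fun i => Nat.le_add_left _ _
  have hSmono : Monotone S := fun i j hij =>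
    add_le_add (Finset.sup_mono (Finset.range_mono (Nat.succ_le_succ hij))) hij
  -- the diagonal index
  let ι : ℕ → ℕ := fun N => Nat.findGreatest (fun i => S i ≤ N) N
  refine ⟨ι, ?_, ?_⟩
  · -- `ι → ∞`: for `N ≥ S i` we have `ι N ≥ i`
    refine tendsto_atTop_atTop.2 fun i => ⟨S i, fun N hN => ?_⟩
    exact Nat.le_findGreatest ((hSi i).trans hN) hN
  · -- eventually `S (ι N) ≤ N`, hence `T (ι N) ≤ N`
    refine eventually_atTop.2 ⟨S 0, fun N hN => hT _ _ ((hST _).trans ?_)⟩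
    have hex : ∃ i, i ≤ N ∧ S i ≤ N := ⟨0, Nat.zero_le _, hN⟩
    obtain ⟨i, hiN, hSiN⟩ := hex
    exact Nat.findGreatest_spec (P := fun i => S i ≤ N) hiN hSiN

end Summit.AtomisticToContinuum.HydrodynamicLimit.Theorems.NearConstantShortTimeHL
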